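import Mathlib
import Summits.NavierStokesRegularity.NavierStokesRegularity.Theses.RootDecompLitSlice
import HarnessLib

/-!
# RootDecompLitSlice — glue `NoSupercriticalTameScar_of_cells` (stmt-NavierStokesRegularity-31735) PROVED

Route N16 `route-NavierStokesRegularity-RootDecompLitSlice`, the GLUE of the PARABOLIC CLOCK split of U
`NoSupercriticalTameScar` 29565 (lens-6 g8; writer evidence `GlueProofN16U.lean`, not mounted in this seat's jail —
re-proved here on the tree decls): `CritTameScarIsCritical → AbruptTameScarIsCritical → NoSupercriticalTameScar`. The
two cells are the parent with the CRITICALLY-TAME clock predicate resp. its negation inserted before the conclusion,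
so the glue is excluded middle. Pure logic; Navier–Stokes regularity is NOT proved by anything here (rung 0).
-/

-- the summit and its single sub-problem share the name (CONVENTIONS §1), as in every Theorems file
set_option linter.dupNamespace false

namespace Summit.NavierStokesRegularity.NavierStokesRegularity.Theorems.LitSlice

open Summit.NavierStokesRegularity.NavierStokesRegularity.Theses.RootDecompLitSlice

/-- **Glue of the parabolic-clock split** (stmt-NavierStokesRegularity-31735): critically-tame cell + abrupt cell ⟹
parent, by excluded middle on the clock predicate. [folklore] -/
theorem noSupercriticalTameScar_of_cells_proof : NoSupercriticalTameScar_of_cells := by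
  unfold NoSupercriticalTameScar_of_cells NoSupercriticalTameScar CritTameScarIsCritical
    AbruptTameScarIsCritical
  intro hC hA ν T hν hT u p hmax hLH hdec hcont
  exact (Classical.em _).elim (fun h => hC ν T hν hT u p hmax hLH hdec hcont h)
    (fun h => hA ν T hν hT u p hmax hLH hdec hcont h)

/-- **Exactness of the parabolic-clock split**: parent ↔ critically-tame cell ∧ abrupt cell. [folklore] -/
theorem noSupercriticalTameScar_iff_cells :
    NoSupercriticalTameScar ↔ CritTameScarIsCritical ∧ AbruptTameScarIsCritical := by
  constructor
  · intro h
    refine ⟨?_, ?_⟩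
    · intro ν T hν hT u p hmax hLH hdec hcont _
      exact h ν T hν hT u p hmax hLH hdec hcont
    · intro ν T hν hT u p hmax hLH hdec hcont _
      exact h ν T hν hT u p hmax hLH hdec hcont
  · rintro ⟨hC, hA⟩
    exact noSupercriticalTameScar_of_cells_proof hC hA

end Summit.NavierStokesRegularity.NavierStokesRegularity.Theorems.LitSlice
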